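import Literature.Topology.FourManifolds.OneOneTransversality
import Literature.Topology.FourManifolds.OneJetGenericMapsExist
import HarnessLib

/-!
# The quadratic family through an immersion: jets, the incidence system on jets, realisation

Topic `Literature/Topology/FourManifolds` (programme of the fact
`Literature.Topology.FourManifolds.exists_isSimplifiedBrokenLefschetzFibration`, Baykur–Saeki 2017, §2.1).
`OneOneTransversality.lean` proved second-order genericity for the family
`f + A + B(·, ·)` on an open set of `ℝ⁴`.  On a compact 4-manifold `M` the global family is
`f + A ∘ h + B(h, h)` for an embedding `h : M → ℝᴺ` (as in `OneJetGenericMapsExist.lean` at first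
order), whose chart representatives are the COMPOSITE families
`F_θ = f + θ.1 ∘ h + θ.2(h, h)` (`OneJet.quadPerturbComp f h θ`) with `h` an immersion of an
open set of `ℝ⁴`.  This file is the calculus of that family and the algebra that reduces its
Thom–Sard argument to the one already done:

* `OneJet.sysOfJetsL ℓ_A ℓ_B a c y τ` — **the incidence system of `S_{1,1}` as a continuous linear
  map of the pair of jets** `(J₁, J₂) ↦ (ℓ_c ∘ J₁, ℓ_c ∘ J₂(·, k) + τ ℓ_B ∘ J₁, ℓ_B(J₁ k))`;
  `oneOneSystem g u = sysOfJetsL(dg_x, D²g_x)`, `oneOneParam = sysOfJetsL ∘ (jets of the variation)`,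
  and joint smoothness `contDiffOn_sysOfJetsL_apply` in `(c, y, τ, J₁, J₂)`;
* jets of the composite family (`h` `C^∞` on `Ω`): `dF_θ = df + (θ.1 + θ.2(h y) + θ.2ᵀ(h y)) ∘ dh`,
  `D²F_θ(v, w) = D²f(v, w) + (θ.1 + θ.2(hy) + θ.2ᵀ(hy))(D²h(v,w)) + (θ.2 + θ.2ᵀ)(dh v, dh w)`
  (`fderiv_quadPerturbComp_of_mem`, `fderiv_fderiv_quadPerturbComp_of_mem` with the continuous
  linear `bilinearCompL A : β ↦ β(A·, A·)` and `compTwoL K : α ↦ α ∘ K`), joint smoothness in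
  `(θ, y)`, and the parameter derivatives (`jetCompL`, affine family);
* `OneJet.exists_jets_eq` — **jet realisation**: if `dh_x` is injective, every pair
  `(N, S)` of a 1-jet and a SYMMETRIC 2-jet at `x` is the pair of jets of some variation `θ`
  (`α := N ∘ L`, `β := (S - α ∘ D²h_x)(L·, L·)` for a left inverse `L` of `dh_x`).

Everything is proved; the definitions carry unfolding lemmas; no named fact (D-0026).

## References

* M. Golubitsky, V. Guillemin, *Stable Mappings and Their Singularities*, GTM 14 (1973), Ch. II
  §4, proof of Thm. 4.9 (polynomial perturbations realise jets). [GolubitskyGuillemin1973]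
* V. Guillemin, A. Pollack, *Differential Topology* (1974), Ch. 2 §3 (families through an
  embedding). [GuilleminPollack2010]
-/

noncomputable section

set_option maxSynthPendingDepth 2

open Set Function Filter Module
open scoped ContDiff Topology

namespace Literature.Topology.FourManifolds

namespace OneJet

/-! ### Two continuous linear operations on jets -/

section LinearAlgebra

variable {E G F : Type*} [NormedAddCommGroup E] [NormedSpace ℝ E] [NormedAddCommGroup G]
  [NormedSpace ℝ G] [NormedAddCommGroup F] [NormedSpace ℝ F]

/-- `compTwoL K : α ↦ (v ↦ α ∘ K v)`, the push-forward of a 2-jet `K : E → E → G` by a linear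
`α : G → F`, as a continuous linear map in `α`. [folklore] -/
def compTwoL (K : E →L[ℝ] E →L[ℝ] G) : (G →L[ℝ] F) →L[ℝ] (E →L[ℝ] E →L[ℝ] F) :=
  ((ContinuousLinearMap.compL ℝ E (E →L[ℝ] G) (E →L[ℝ] F)).flip K).comp
    (ContinuousLinearMap.compL ℝ E G F)

/-- `compTwoL K α v w = α (K v w)`. [folklore] -/
@[simp]
theorem compTwoL_apply (K : E →L[ℝ] E →L[ℝ] G) (α : G →L[ℝ] F) (v w : E) :
    compTwoL K α v w = α (K v w) := by
  simp [compTwoL]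

variable (E) in
/-- The flip `(E →L G →L F) → (G →L E →L F)` as a continuous linear map. [folklore] -/
def flipGL : (E →L[ℝ] G →L[ℝ] F) →L[ℝ] (G →L[ℝ] E →L[ℝ] F) :=
  ((ContinuousLinearMap.flipₗᵢ ℝ E G F).toContinuousLinearEquiv : _ →L[ℝ] _)

/-- `flipGL E B = B.flip`. [folklore] -/
@[simp]
theorem flipGL_apply (B : E →L[ℝ] G →L[ℝ] F) : flipGL E B = B.flip := rfl

/-- `bilinearCompL A : β ↦ β(A·, A·)`, as a continuous linear map in `β`. [folklore] -/
def bilinearCompL (A : E →L[ℝ] G) : (G →L[ℝ] G →L[ℝ] F) →L[ℝ] (E →L[ℝ] E →L[ℝ] F) :=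
  (flipGL E (G := E) (F := F)).comp
    (((ContinuousLinearMap.compL ℝ E G (E →L[ℝ] F)).flip A).comp
      ((flipGL E (G := G) (F := F)).comp ((ContinuousLinearMap.compL ℝ E G (G →L[ℝ] F)).flip A)))

/-- `bilinearCompL A β v w = β (A v) (A w)`. [folklore] -/
@[simp]
theorem bilinearCompL_apply (A : E →L[ℝ] G) (β : G →L[ℝ] G →L[ℝ] F) (v w : E) :
    bilinearCompL A β v w = β (A v) (A w) := by
  simp [bilinearCompL]

/-- `bilinearCompL A β = β.bilinearComp A A`. [folklore] -/
theorem bilinearCompL_eq (A : E →L[ℝ] G) (β : G →L[ℝ] G →L[ℝ] F) :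
    bilinearCompL A β = β.bilinearComp A A := by
  ext v w
  simp

end LinearAlgebra

/-! ### The incidence system as a linear function of the jets -/

section System

/-- Local notation for this file: the model space `ℝⁿ = EuclideanSpace ℝ (Fin n)`. -/
local notation "𝔼 " n:arg => EuclideanSpace ℝ (Fin n)

/-- Local notation: pairs of a 1-jet and a 2-jet of maps `ℝ⁴ → ℝ²`. -/
local notation "J₂" => ((𝔼 4 →L[ℝ] 𝔼 2) × (𝔼 4 →L[ℝ] 𝔼 4 →L[ℝ] 𝔼 2))

/-- **The incidence system of `S_{1,1}` as a continuous linear map of the jets** `(J₁, J₂)`, for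
fixed chart data `(ℓ_A, ℓ_B, a)` and unknowns `(c, y, τ)`:
`(J₁, J₂) ↦ (ℓ_c ∘ J₁, ℓ_c ∘ J₂(·, k) + τ ℓ_B ∘ J₁, ℓ_B(J₁ k))`. [folklore] -/
def sysOfJetsL (ℓA ℓB : (𝔼 2) →L[ℝ] ℝ) (a : Fin 4) (c : ℝ) (y : 𝔼 3) (τ : ℝ) :
    J₂ →L[ℝ] Values :=
  ((ContinuousLinearMap.compL ℝ (𝔼 4) (𝔼 2) ℝ (ℓA + c • ℓB)).comp
      (ContinuousLinearMap.fst ℝ _ _)).prod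
    ((((ContinuousLinearMap.compL ℝ (𝔼 4) (𝔼 2) ℝ (ℓA + c • ℓB)).comp
          ((ContinuousLinearMap.apply ℝ (𝔼 4 →L[ℝ] 𝔼 2) (radVec a y)).comp
            ((flipL (E := 𝔼 4) (F := 𝔼 2)).comp (ContinuousLinearMap.snd ℝ _ _)))) +
        (τ • ContinuousLinearMap.compL ℝ (𝔼 4) (𝔼 2) ℝ ℓB).comp (ContinuousLinearMap.fst ℝ _ _)).prod
      ((ℓB.comp (ContinuousLinearMap.apply ℝ (𝔼 2) (radVec a y))).comp
        (ContinuousLinearMap.fst ℝ _ _)))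

/-- `sysOfJetsL` evaluated. [folklore] -/
theorem sysOfJetsL_apply (ℓA ℓB : (𝔼 2) →L[ℝ] ℝ) (a : Fin 4) (c : ℝ) (y : 𝔼 3) (τ : ℝ)
    (J : J₂) :
    sysOfJetsL ℓA ℓB a c y τ J =
      ((ℓA + c • ℓB).comp J.1,
        ((ℓA + c • ℓB).comp (J.2.flip (radVec a y)) + τ • ℓB.comp J.1,
          ℓB (J.1 (radVec a y)))) := by
  simp only [sysOfJetsL, ContinuousLinearMap.prod_apply, ContinuousLinearMap.coe_comp,
    comp_apply, ContinuousLinearMap.compL_apply, ContinuousLinearMap.apply_apply, flipL_apply,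
    _root_.add_apply, _root_.smul_apply, ContinuousLinearMap.coe_fst', ContinuousLinearMap.coe_snd']

/-- **The system of a map is `sysOfJetsL` of its jets.** [folklore] -/
theorem oneOneSystem_eq_sysOfJetsL (ℓA ℓB : (𝔼 2) →L[ℝ] ℝ) (a : Fin 4) (g : 𝔼 4 → 𝔼 2)
    (x : 𝔼 4) (c : ℝ) (y : 𝔼 3) (τ : ℝ) :
    oneOneSystem ℓA ℓB a g (x, (c, (y, τ))) =
      sysOfJetsL ℓA ℓB a c y τ (fderiv ℝ g x, fderiv ℝ (fderiv ℝ g) x) := by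
  rw [sysOfJetsL_apply, oneOneSystem_apply]

/-- **The parameter derivative of the quadratic family is `sysOfJetsL` of the jets of the
variation.** [folklore] -/
theorem oneOneParam_eq_sysOfJetsL (ℓA ℓB : (𝔼 2) →L[ℝ] ℝ) (a : Fin 4) (x : 𝔼 4) (c : ℝ)
    (y : 𝔼 3) (τ : ℝ) (ϑ : J₂) :
    oneOneParam ℓA ℓB a x c y τ ϑ =
      sysOfJetsL ℓA ℓB a c y τ (jetOneParam x ϑ, jetTwoParam (𝔼 4) (𝔼 2) ϑ) := by
  rw [sysOfJetsL_apply, oneOneParam_apply]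

/-- **Joint smoothness of the system in the unknowns and the jets**: if `c, y, τ, J₁, J₂` are
`C^∞` functions on `S`, so is `z ↦ sysOfJetsL ℓA ℓB a (c z) (y z) (τ z) (J₁ z, J₂ z)`. [folklore] -/
theorem contDiffOn_sysOfJetsL_apply {X : Type*} [NormedAddCommGroup X] [NormedSpace ℝ X]
    (ℓA ℓB : (𝔼 2) →L[ℝ] ℝ) (a : Fin 4) {S : Set X} {c τ : X → ℝ} {y : X → 𝔼 3}
    {J₁f : X → (𝔼 4 →L[ℝ] 𝔼 2)} {J₂f : X → (𝔼 4 →L[ℝ] 𝔼 4 →L[ℝ] 𝔼 2)}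
    (hc : ContDiffOn ℝ ∞ c S) (hy : ContDiffOn ℝ ∞ y S) (hτ : ContDiffOn ℝ ∞ τ S)
    (hJ₁ : ContDiffOn ℝ ∞ J₁f S) (hJ₂ : ContDiffOn ℝ ∞ J₂f S) :
    ContDiffOn ℝ ∞ (fun z => sysOfJetsL ℓA ℓB a (c z) (y z) (τ z) (J₁f z, J₂f z)) S := by
  have hℓ : ContDiffOn ℝ ∞ (fun z => ℓA + c z • ℓB) S :=
    contDiffOn_const.add (hc.smul contDiffOn_const)
  have hk : ContDiffOn ℝ ∞ (fun z => radVec a (y z)) S := (contDiff_radVec a).comp_contDiffOn hy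
  have hflip : ContDiff ℝ ∞ fun B : 𝔼 4 →L[ℝ] 𝔼 4 →L[ℝ] 𝔼 2 => B.flip :=
    (ContinuousLinearMap.flipₗᵢ ℝ (𝔼 4) (𝔼 4) (𝔼 2)).contDiff
  have h1 : ContDiffOn ℝ ∞ (fun z => (ℓA + c z • ℓB).comp (J₁f z)) S := hℓ.clm_comp hJ₁
  have h2a : ContDiffOn ℝ ∞ (fun z => (J₂f z).flip (radVec a (y z))) S :=
    (hflip.comp_contDiffOn hJ₂).clm_apply hk
  have h2 : ContDiffOn ℝ ∞ (fun z => (ℓA + c z • ℓB).comp ((J₂f z).flip (radVec a (y z))) +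
      τ z • ℓB.comp (J₁f z)) S :=
    (hℓ.clm_comp h2a).add (hτ.smul (contDiffOn_const.clm_comp hJ₁))
  have h3 : ContDiffOn ℝ ∞ (fun z => ℓB (J₁f z (radVec a (y z)))) S :=
    contDiffOn_const.clm_apply (hJ₁.clm_apply hk)
  refine (h1.prodMk (h2.prodMk h3)).congr fun z _ => ?_
  rw [sysOfJetsL_apply]

end System

/-! ### The composite family and its jets -/

section Comp

/-- Local notation for this file: the model space `ℝⁿ = EuclideanSpace ℝ (Fin n)`. -/
local notation "𝔼 " n:arg => EuclideanSpace ℝ (Fin n)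

variable {G : Type} [NormedAddCommGroup G] [NormedSpace ℝ G]

/-- **The quadratic family through a map `h`**: `F_θ = f + θ.1 ∘ h + θ.2(h, h)`,
`θ = (A, B) ∈ Hom(G, ℝ²) × Bil(G × G, ℝ²)` — the chart representative of the global family
`f + A ∘ ι + B(ι, ι)` of an embedded manifold. [cite: GuilleminPollack2010, Ch. 2 §3] -/
def quadPerturbComp (f : 𝔼 4 → 𝔼 2) (h : 𝔼 4 → G) (θ : (G →L[ℝ] 𝔼 2) × (G →L[ℝ] G →L[ℝ] 𝔼 2)) :
    𝔼 4 → 𝔼 2 :=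
  fun y => f y + θ.1 (h y) + θ.2 (h y) (h y)

/-- Unfolding `quadPerturbComp`. [folklore] -/
@[simp]
theorem quadPerturbComp_apply (f : 𝔼 4 → 𝔼 2) (h : 𝔼 4 → G)
    (θ : (G →L[ℝ] 𝔼 2) × (G →L[ℝ] G →L[ℝ] 𝔼 2)) (y : 𝔼 4) :
    quadPerturbComp f h θ y = f y + θ.1 (h y) + θ.2 (h y) (h y) := rfl

/-- `F_θ = f + Q_θ ∘ h` with `Q_θ = quadPerturb 0 θ` the quadratic polynomial map. [folklore] -/
theorem quadPerturbComp_eq (f : 𝔼 4 → 𝔼 2) (h : 𝔼 4 → G)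
    (θ : (G →L[ℝ] 𝔼 2) × (G →L[ℝ] G →L[ℝ] 𝔼 2)) :
    quadPerturbComp f h θ = fun y => f y + quadPerturb (fun _ : G => (0 : 𝔼 2)) θ (h y) := by
  funext y
  simp [quadPerturb, add_assoc]

/-- The quadratic polynomial map `Q_θ` has derivative `jetOneParam p θ = θ.1 + θ.2 p + θ.2ᵀ p`
at `p`. [folklore] -/
theorem hasFDerivAt_quadPoly (θ : (G →L[ℝ] 𝔼 2) × (G →L[ℝ] G →L[ℝ] 𝔼 2)) (p : G) :
    HasFDerivAt (quadPerturb (fun _ : G => (0 : 𝔼 2)) θ) (jetOneParam (F := 𝔼 2) p θ) p := by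
  have h := hasFDerivAt_quadPerturb (f := fun _ : G => (0 : 𝔼 2)) (y := p)
    (differentiableAt_const _) θ
  refine h.congr_fderiv ?_
  rw [jetOneParam_apply]
  simp

/-- `Q_θ` is `C^∞`, with `D²Q_θ ≡ jetTwoParam θ = θ.2 + θ.2ᵀ`. [folklore] -/
theorem contDiff_quadPoly (θ : (G →L[ℝ] 𝔼 2) × (G →L[ℝ] G →L[ℝ] 𝔼 2)) :
    ContDiff ℝ ∞ (quadPerturb (fun _ : G => (0 : 𝔼 2)) θ) := by
  rw [← contDiffOn_univ]
  exact contDiffOn_quadPerturb contDiffOn_const θ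

/-- `dQ_θ = (p ↦ jetOneParam p θ)`. [folklore] -/
theorem fderiv_quadPoly (θ : (G →L[ℝ] 𝔼 2) × (G →L[ℝ] G →L[ℝ] 𝔼 2)) :
    fderiv ℝ (quadPerturb (fun _ : G => (0 : 𝔼 2)) θ) = fun p => jetOneParam (F := 𝔼 2) p θ :=
  funext fun p => (hasFDerivAt_quadPoly θ p).fderiv

/-- `D²Q_θ(p) = jetTwoParam θ`. [folklore] -/
theorem fderiv_fderiv_quadPoly (θ : (G →L[ℝ] 𝔼 2) × (G →L[ℝ] G →L[ℝ] 𝔼 2)) (p : G) :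
    fderiv ℝ (fderiv ℝ (quadPerturb (fun _ : G => (0 : 𝔼 2)) θ)) p = jetTwoParam G (𝔼 2) θ := by
  rw [fderiv_fderiv_quadPerturb_of_mem isOpen_univ contDiffOn_const θ (mem_univ p)]
  have : fderiv ℝ (fderiv ℝ fun _ : G => (0 : 𝔼 2)) p = 0 := by
    simp
  rw [this, zero_add, jetTwoParam_apply]

variable {f : 𝔼 4 → 𝔼 2} {h : 𝔼 4 → G} {Ω : Set (𝔼 4)}

/-- **The differential of the composite family**: `dF_θ(y) = df(y) + (θ.1 + θ.2(hy) + θ.2ᵀ(hy)) ∘ dh(y)`.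
[folklore] -/
theorem hasFDerivAt_quadPerturbComp {y : 𝔼 4} {f' : 𝔼 4 →L[ℝ] 𝔼 2} {h' : 𝔼 4 →L[ℝ] G}
    (hf : HasFDerivAt f f' y) (hh : HasFDerivAt h h' y)
    (θ : (G →L[ℝ] 𝔼 2) × (G →L[ℝ] G →L[ℝ] 𝔼 2)) :
    HasFDerivAt (quadPerturbComp f h θ) (f' + (jetOneParam (F := 𝔼 2) (h y) θ).comp h') y := by
  rw [quadPerturbComp_eq]
  exact hf.add ((hasFDerivAt_quadPoly θ (h y)).comp y hh)

/-- `fderiv` of the composite family on an open set of smoothness. [folklore] -/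
theorem fderiv_quadPerturbComp_of_mem (hΩ : IsOpen Ω) (hf : ContDiffOn ℝ ∞ f Ω)
    (hh : ContDiffOn ℝ ∞ h Ω) (θ : (G →L[ℝ] 𝔼 2) × (G →L[ℝ] G →L[ℝ] 𝔼 2)) {y : 𝔼 4}
    (hy : y ∈ Ω) :
    fderiv ℝ (quadPerturbComp f h θ) y =
      fderiv ℝ f y + (jetOneParam (F := 𝔼 2) (h y) θ).comp (fderiv ℝ h y) :=
  (hasFDerivAt_quadPerturbComp
    ((hf.contDiffAt (hΩ.mem_nhds hy)).differentiableAt (by simp)).hasFDerivAt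
    ((hh.contDiffAt (hΩ.mem_nhds hy)).differentiableAt (by simp)).hasFDerivAt θ).fderiv

/-- The composite family is `C^∞` where `f` and `h` are. [folklore] -/
theorem contDiffOn_quadPerturbComp (hf : ContDiffOn ℝ ∞ f Ω) (hh : ContDiffOn ℝ ∞ h Ω)
    (θ : (G →L[ℝ] 𝔼 2) × (G →L[ℝ] G →L[ℝ] 𝔼 2)) :
    ContDiffOn ℝ ∞ (quadPerturbComp f h θ) Ω := by
  rw [quadPerturbComp_eq]
  exact hf.add ((contDiff_quadPoly θ).comp_contDiffOn hh)

/-- `2 ≤ ∞` in `WithTop ℕ∞`. [folklore] -/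
private theorem two_le_infty₀ : (2 : WithTop ℕ∞) ≤ ∞ := WithTop.coe_le_coe.2 le_top

/-- **The second differential of the composite family**, applied:
`D²F_θ(y)(v, w) = D²f(y)(v, w) + (θ.1 + θ.2(hy) + θ.2ᵀ(hy))(D²h(y)(v, w)) + (θ.2 + θ.2ᵀ)(dh v, dh w)`.
[folklore] -/
theorem fderiv_fderiv_quadPerturbComp_apply (hΩ : IsOpen Ω) (hf : ContDiffOn ℝ ∞ f Ω)
    (hh : ContDiffOn ℝ ∞ h Ω) (θ : (G →L[ℝ] 𝔼 2) × (G →L[ℝ] G →L[ℝ] 𝔼 2)) {y : 𝔼 4}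
    (hy : y ∈ Ω) (v w : 𝔼 4) :
    fderiv ℝ (fderiv ℝ (quadPerturbComp f h θ)) y v w =
      fderiv ℝ (fderiv ℝ f) y v w + jetOneParam (F := 𝔼 2) (h y) θ (fderiv ℝ (fderiv ℝ h) y v w) +
        jetTwoParam G (𝔼 2) θ (fderiv ℝ h y v) (fderiv ℝ h y w) := by
  set Q := quadPerturb (fun _ : G => (0 : 𝔼 2)) θ with hQ
  have hQh : ContDiffOn ℝ ∞ (Q ∘ h) Ω := (contDiff_quadPoly θ).comp_contDiffOn hh
  -- `dF_θ = df + d(Q ∘ h)` near `y`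
  have heq : fderiv ℝ (quadPerturbComp f h θ) =ᶠ[𝓝 y] fun z => fderiv ℝ f z + fderiv ℝ (Q ∘ h) z := by
    filter_upwards [hΩ.mem_nhds hy] with z hz
    have hfz : DifferentiableAt ℝ f z := (hf.contDiffAt (hΩ.mem_nhds hz)).differentiableAt (by simp)
    have hQz : DifferentiableAt ℝ (Q ∘ h) z :=
      (hQh.contDiffAt (hΩ.mem_nhds hz)).differentiableAt (by simp)
    rw [quadPerturbComp_eq, ← hQ]
    exact fderiv_add hfz hQz
  rw [heq.fderiv_eq]
  have hf' : ContDiffOn ℝ ∞ (fderiv ℝ f) Ω := hf.fderiv_of_isOpen hΩ (by simp)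
  have hQh' : ContDiffOn ℝ ∞ (fderiv ℝ (Q ∘ h)) Ω := hQh.fderiv_of_isOpen hΩ (by simp)
  have hdf : DifferentiableAt ℝ (fderiv ℝ f) y :=
    (hf'.contDiffAt (hΩ.mem_nhds hy)).differentiableAt (by simp)
  have hdQ : DifferentiableAt ℝ (fderiv ℝ (Q ∘ h)) y :=
    (hQh'.contDiffAt (hΩ.mem_nhds hy)).differentiableAt (by simp)
  rw [fderiv_fun_add hdf hdQ, _root_.add_apply, _root_.add_apply]
  -- the second-order chain rule for `Q ∘ h`
  have hQ2 : ContDiffAt ℝ 2 Q (h y) := (contDiff_quadPoly θ).contDiffAt.of_le two_le_infty₀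
  have hh2 : ContDiffAt ℝ 2 h y := (hh.contDiffAt (hΩ.mem_nhds hy)).of_le two_le_infty₀
  rw [fderiv_fderiv_comp_apply_eq_add hQ2 hh2 v w, hQ, fderiv_fderiv_quadPoly, fderiv_quadPoly,
    add_assoc]

/-- **The second differential of the composite family** as a continuous linear map:
`D²F_θ(y) = D²f(y) + compTwoL (D²h y) (jetOneParam (h y) θ) + bilinearCompL (dh y) (jetTwoParam θ)`.
[folklore] -/
theorem fderiv_fderiv_quadPerturbComp_of_mem (hΩ : IsOpen Ω) (hf : ContDiffOn ℝ ∞ f Ω)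
    (hh : ContDiffOn ℝ ∞ h Ω) (θ : (G →L[ℝ] 𝔼 2) × (G →L[ℝ] G →L[ℝ] 𝔼 2)) {y : 𝔼 4}
    (hy : y ∈ Ω) :
    fderiv ℝ (fderiv ℝ (quadPerturbComp f h θ)) y =
      fderiv ℝ (fderiv ℝ f) y + compTwoL (fderiv ℝ (fderiv ℝ h) y) (jetOneParam (F := 𝔼 2) (h y) θ) +
        bilinearCompL (fderiv ℝ h y) (jetTwoParam G (𝔼 2) θ) := by
  ext v w
  rw [fderiv_fderiv_quadPerturbComp_apply hΩ hf hh θ hy v w]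
  simp only [_root_.add_apply, compTwoL_apply, bilinearCompL_apply]

/-! ### Joint smoothness in `(θ, y)` -/

/-- Local notation: the parameter space of the composite family. -/
local notation "PG" => ((G →L[ℝ] 𝔼 2) × (G →L[ℝ] G →L[ℝ] 𝔼 2))

/-- `(θ, p) ↦ jetOneParam p θ = θ.1 + θ.2 p + θ.2ᵀ p` is `C^∞` (polynomial). [folklore] -/
theorem contDiff_jetOneParam_uncurry :
    ContDiff ℝ ∞ fun z : PG × G => jetOneParam (F := 𝔼 2) z.2 z.1 := by
  have h1 : ContDiff ℝ ∞ fun z : PG × G => z.1.1 := contDiff_fst.comp contDiff_fst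
  have h2 : ContDiff ℝ ∞ fun z : PG × G => z.1.2 z.2 :=
    (contDiff_snd.comp contDiff_fst).clm_apply contDiff_snd
  have hflip : ContDiff ℝ ∞ fun B : G →L[ℝ] G →L[ℝ] 𝔼 2 => B.flip :=
    (ContinuousLinearMap.flipₗᵢ ℝ G G (𝔼 2)).contDiff
  have h3 : ContDiff ℝ ∞ fun z : PG × G => z.1.2.flip z.2 :=
    (hflip.comp (contDiff_snd.comp contDiff_fst)).clm_apply contDiff_snd
  have : (fun z : PG × G => jetOneParam (F := 𝔼 2) z.2 z.1) =
      fun z => z.1.1 + (z.1.2 z.2 + z.1.2.flip z.2) := by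
    funext z; rw [jetOneParam_apply]
  rw [this]
  exact h1.add (h2.add h3)

/-- **Joint smoothness of the 1-jet of the composite family** on `univ × Ω`. [folklore] -/
theorem contDiffOn_fderiv_quadPerturbComp (hΩ : IsOpen Ω) (hf : ContDiffOn ℝ ∞ f Ω)
    (hh : ContDiffOn ℝ ∞ h Ω) :
    ContDiffOn ℝ ∞ (fun z : PG × 𝔼 4 => fderiv ℝ (quadPerturbComp f h z.1) z.2) (univ ×ˢ Ω) := by
  have hf' : ContDiffOn ℝ ∞ (fderiv ℝ f) Ω := hf.fderiv_of_isOpen hΩ (by simp)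
  have hh' : ContDiffOn ℝ ∞ (fderiv ℝ h) Ω := hh.fderiv_of_isOpen hΩ (by simp)
  have hsnd : MapsTo (Prod.snd : PG × 𝔼 4 → 𝔼 4) (univ ×ˢ Ω) Ω := fun z hz => hz.2
  have hα : ContDiffOn ℝ ∞ (fun z : PG × 𝔼 4 => jetOneParam (F := 𝔼 2) (h z.2) z.1) (univ ×ˢ Ω) := by
    have hπ : ContDiffOn ℝ ∞ (fun z : PG × 𝔼 4 => (z.1, h z.2)) (univ ×ˢ Ω) :=
      contDiffOn_fst.prodMk (hh.comp contDiffOn_snd hsnd)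
    have h := contDiff_jetOneParam_uncurry.comp_contDiffOn hπ
    exact h
  refine ContDiffOn.congr ?_ fun z hz => fderiv_quadPerturbComp_of_mem hΩ hf hh z.1 hz.2
  exact (hf'.comp contDiffOn_snd hsnd).add (hα.clm_comp (hh'.comp contDiffOn_snd hsnd))

/-- `(A, β) ↦ bilinearCompL A β` is `C^∞` jointly. [folklore] -/
theorem contDiff_bilinearCompL_uncurry :
    ContDiff ℝ ∞ fun z : (𝔼 4 →L[ℝ] G) × (G →L[ℝ] G →L[ℝ] 𝔼 2) => bilinearCompL z.1 z.2 := by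
  have hflip1 : ContDiff ℝ ∞ fun B : (𝔼 4) →L[ℝ] G →L[ℝ] 𝔼 2 => B.flip :=
    (ContinuousLinearMap.flipₗᵢ ℝ (𝔼 4) G (𝔼 2)).contDiff
  have hflip2 : ContDiff ℝ ∞ fun B : (𝔼 4) →L[ℝ] (𝔼 4) →L[ℝ] 𝔼 2 => B.flip :=
    (ContinuousLinearMap.flipₗᵢ ℝ (𝔼 4) (𝔼 4) (𝔼 2)).contDiff
  -- `β.comp A`, flip, `.comp A`, flip
  have h1 : ContDiff ℝ ∞ fun z : (𝔼 4 →L[ℝ] G) × (G →L[ℝ] G →L[ℝ] 𝔼 2) => z.2.comp z.1 :=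
    contDiff_snd.clm_comp contDiff_fst
  have h2 : ContDiff ℝ ∞ fun z : (𝔼 4 →L[ℝ] G) × (G →L[ℝ] G →L[ℝ] 𝔼 2) =>
      ((z.2.comp z.1).flip).comp z.1 := (hflip1.comp h1).clm_comp contDiff_fst
  have heq : (fun z : (𝔼 4 →L[ℝ] G) × (G →L[ℝ] G →L[ℝ] 𝔼 2) => bilinearCompL z.1 z.2) =
      fun z => (((z.2.comp z.1).flip).comp z.1).flip := by
    funext z
    ext v w
    simp
  rw [heq]
  exact hflip2.comp h2

/-- `(K, α) ↦ compTwoL K α` is `C^∞` jointly. [folklore] -/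
theorem contDiff_compTwoL_uncurry :
    ContDiff ℝ ∞ fun z : (𝔼 4 →L[ℝ] 𝔼 4 →L[ℝ] G) × (G →L[ℝ] 𝔼 2) => compTwoL z.1 z.2 := by
  have heq : (fun z : (𝔼 4 →L[ℝ] 𝔼 4 →L[ℝ] G) × (G →L[ℝ] 𝔼 2) => compTwoL z.1 z.2) =
      fun z => (ContinuousLinearMap.compL ℝ (𝔼 4) G (𝔼 2) z.2).comp z.1 := by
    funext z
    ext v w
    simp
  rw [heq]
  exact ((ContinuousLinearMap.compL ℝ (𝔼 4) G (𝔼 2)).contDiff.comp contDiff_snd).clm_comp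
    contDiff_fst

/-- **Joint smoothness of the 2-jet of the composite family** on `univ × Ω`. [folklore] -/
theorem contDiffOn_fderiv_fderiv_quadPerturbComp (hΩ : IsOpen Ω) (hf : ContDiffOn ℝ ∞ f Ω)
    (hh : ContDiffOn ℝ ∞ h Ω) :
    ContDiffOn ℝ ∞ (fun z : PG × 𝔼 4 => fderiv ℝ (fderiv ℝ (quadPerturbComp f h z.1)) z.2)
      (univ ×ˢ Ω) := by
  have hf' : ContDiffOn ℝ ∞ (fderiv ℝ f) Ω := hf.fderiv_of_isOpen hΩ (by simp)
  have hf'' : ContDiffOn ℝ ∞ (fderiv ℝ (fderiv ℝ f)) Ω := hf'.fderiv_of_isOpen hΩ (by simp)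
  have hh' : ContDiffOn ℝ ∞ (fderiv ℝ h) Ω := hh.fderiv_of_isOpen hΩ (by simp)
  have hh'' : ContDiffOn ℝ ∞ (fderiv ℝ (fderiv ℝ h)) Ω := hh'.fderiv_of_isOpen hΩ (by simp)
  have hsnd : MapsTo (Prod.snd : PG × 𝔼 4 → 𝔼 4) (univ ×ˢ Ω) Ω := fun z hz => hz.2
  have hα : ContDiffOn ℝ ∞ (fun z : PG × 𝔼 4 => jetOneParam (F := 𝔼 2) (h z.2) z.1) (univ ×ˢ Ω) := by
    have hπ : ContDiffOn ℝ ∞ (fun z : PG × 𝔼 4 => (z.1, h z.2)) (univ ×ˢ Ω) :=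
      contDiffOn_fst.prodMk (hh.comp contDiffOn_snd hsnd)
    have h := contDiff_jetOneParam_uncurry.comp_contDiffOn hπ
    exact h
  have hβ : ContDiff ℝ ∞ fun z : PG × 𝔼 4 => jetTwoParam G (𝔼 2) z.1 :=
    (jetTwoParam G (𝔼 2)).contDiff.comp contDiff_fst
  have h2 : ContDiffOn ℝ ∞ (fun z : PG × 𝔼 4 =>
      compTwoL (fderiv ℝ (fderiv ℝ h) z.2) (jetOneParam (F := 𝔼 2) (h z.2) z.1)) (univ ×ˢ Ω) := by
    have h := contDiff_compTwoL_uncurry.comp_contDiffOn ((hh''.comp contDiffOn_snd hsnd).prodMk hα)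
    exact h
  have h3 : ContDiffOn ℝ ∞ (fun z : PG × 𝔼 4 =>
      bilinearCompL (fderiv ℝ h z.2) (jetTwoParam G (𝔼 2) z.1)) (univ ×ˢ Ω) := by
    have h := contDiff_bilinearCompL_uncurry.comp_contDiffOn
      ((hh'.comp contDiffOn_snd hsnd).prodMk hβ.contDiffOn)
    exact h
  refine ContDiffOn.congr ?_ fun z hz => fderiv_fderiv_quadPerturbComp_of_mem hΩ hf hh z.1 hz.2
  exact ((hf''.comp contDiffOn_snd hsnd).add h2).add h3

/-! ### The parameter derivative of the jets -/

/-- **The jets of the composite family are affine in `θ`**, with linear part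
`jetCompL p A K : θ ↦ ((θ.1 + θ.2 p + θ.2ᵀ p) ∘ A, (θ.1 + θ.2 p + θ.2ᵀ p) ∘ K + (θ.2 + θ.2ᵀ)(A·, A·))`
(`p = h y`, `A = dh_y`, `K = D²h_y`). [folklore] -/
def jetCompL (p : G) (A : 𝔼 4 →L[ℝ] G) (K : 𝔼 4 →L[ℝ] 𝔼 4 →L[ℝ] G) :
    PG →L[ℝ] ((𝔼 4 →L[ℝ] 𝔼 2) × (𝔼 4 →L[ℝ] 𝔼 4 →L[ℝ] 𝔼 2)) :=
  (((ContinuousLinearMap.compL ℝ (𝔼 4) G (𝔼 2)).flip A).comp (jetOneParam (F := 𝔼 2) p)).prod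
    ((compTwoL (F := 𝔼 2) K).comp (jetOneParam (F := 𝔼 2) p) +
      (bilinearCompL (F := 𝔼 2) A).comp (jetTwoParam G (𝔼 2)))

/-- `jetCompL` evaluated. [folklore] -/
theorem jetCompL_apply (p : G) (A : 𝔼 4 →L[ℝ] G) (K : 𝔼 4 →L[ℝ] 𝔼 4 →L[ℝ] G) (θ : PG) :
    jetCompL p A K θ =
      ((jetOneParam (F := 𝔼 2) p θ).comp A,
        compTwoL K (jetOneParam (F := 𝔼 2) p θ) + bilinearCompL A (jetTwoParam G (𝔼 2) θ)) := by
  simp only [jetCompL, ContinuousLinearMap.prod_apply, ContinuousLinearMap.coe_comp, comp_apply,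
    ContinuousLinearMap.flip_apply, ContinuousLinearMap.compL_apply, _root_.add_apply]

/-- **The jets of the composite family**: `(dF_θ(y), D²F_θ(y)) = (df(y), D²f(y)) + jetCompL … θ`.
[folklore] -/
theorem jets_quadPerturbComp_of_mem (hΩ : IsOpen Ω) (hf : ContDiffOn ℝ ∞ f Ω)
    (hh : ContDiffOn ℝ ∞ h Ω) (θ : PG) {y : 𝔼 4} (hy : y ∈ Ω) :
    (fderiv ℝ (quadPerturbComp f h θ) y, fderiv ℝ (fderiv ℝ (quadPerturbComp f h θ)) y) =
      (fderiv ℝ f y, fderiv ℝ (fderiv ℝ f) y) +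
        jetCompL (h y) (fderiv ℝ h y) (fderiv ℝ (fderiv ℝ h) y) θ := by
  rw [jetCompL_apply, Prod.mk_add_mk, fderiv_quadPerturbComp_of_mem hΩ hf hh θ hy,
    fderiv_fderiv_quadPerturbComp_of_mem hΩ hf hh θ hy, add_assoc]

/-! ### Jet realisation through an immersion -/

/-- **Jet realisation.**  If `A = dh_x` is injective and `K = D²h_x` is symmetric, every pair
`(N, S)` of a 1-jet and a symmetric 2-jet is the pair of jets at `x` of a variation `θ` of the
composite family: with a left inverse `L` of `A`, `α := N ∘ L`, `β := (S - α ∘ K)(L·, L·)`,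
`θ := (α - β(p, ·), ½ β)`. [cite: GolubitskyGuillemin1973, Ch. II §4, proof of Thm. 4.9] -/
theorem exists_jetCompL_eq [FiniteDimensional ℝ G] {A : 𝔼 4 →L[ℝ] G} (hA : Injective A) {K : 𝔼 4 →L[ℝ] 𝔼 4 →L[ℝ] G}
    (hK : ∀ v w, K v w = K w v) (p : G) (N : 𝔼 4 →L[ℝ] 𝔼 2) {S : 𝔼 4 →L[ℝ] 𝔼 4 →L[ℝ] 𝔼 2}
    (hS : ∀ v w, S v w = S w v) : ∃ θ : PG, jetCompL p A K θ = (N, S) := by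
  obtain ⟨L, hL⟩ := exists_clm_leftInverse hA
  set α : G →L[ℝ] 𝔼 2 := N.comp L with hα
  set β : G →L[ℝ] G →L[ℝ] 𝔼 2 := bilinearCompL L (S - compTwoL K α) with hβ
  have hβs : ∀ u u', β u u' = β u' u := fun u u' => by
    simp only [hβ, bilinearCompL_apply, _root_.sub_apply, compTwoL_apply, hS (L u),
      hK (L u)]
  set B : G →L[ℝ] G →L[ℝ] 𝔼 2 := (1 / 2 : ℝ) • β with hB
  refine ⟨(α - (B p + B.flip p), B), ?_⟩
  have hj1 : jetOneParam (F := 𝔼 2) p (α - (B p + B.flip p), B) = α := by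
    rw [jetOneParam_apply]
    simp
  have hj2 : jetTwoParam G (𝔼 2) (α - (B p + B.flip p), B) = β := by
    rw [jetTwoParam_apply]
    ext u u'
    simp only [_root_.add_apply, ContinuousLinearMap.flip_apply, hB, _root_.smul_apply,
      hβs u' u]
    simp only [PiLp.add_apply, PiLp.smul_apply, smul_eq_mul]
    ring
  rw [jetCompL_apply, hj1, hj2]
  congr 1
  · ext v
    simp [hα, hL v]
  · ext v w
    simp [hβ, hα, hL v, hL w]

end Comp

end OneJet

end Literature.Topology.FourManifolds
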